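import Summits.BirchSwinnertonDyer.BirchSwinnertonDyer.Theorems.ManinLocalTwoThreeDiamondCharacterConductorLaw
import Literature.NumberTheory.EllipticCurves.ModularSymbolsProofs
import Literature.NumberTheory.EllipticCurves.ModularCurve
import HarnessLib

/-!
# es's STEP 2 (D6), VI: the DIAMOND HALF-CHARACTER `w₀(γ) = π₀(c₀·{∞,γ∞}_f / 2)` of an `X₀(N)`-datum satisfies the five `w`-hypotheses of
# `StepTwo.propositionA` in the index-`4` world (D8/D9 ⟹ D6 glue)
(route `ManinLocalTwoThree`, crux C2 `ManinOddAtFour` stmt-BirchSwinnertonDyer-22967; cell bsd-f2-manin, prover p2 gen 21; LEAD card `kummer_diamond` nodes D6/D8/D9;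
`--supports stmt-BirchSwinnertonDyer-22967`)

For `D₀ : ModularParametrizationData W₀ N` put `w₀ γ := D₀.uniformize (D₀.c * cuspSymbol D₀.f γ / 2)` (written out; no definition is introduced).  Then:
* `uniformize_half_cuspSymbol_mul` — `w₀ (γγ′) = w₀ γ + w₀ γ′` ((K1) `cuspSymbol_mul_holds`);
* `uniformize_half_cuspSymbol_add_self` — `w₀ γ + w₀ γ = 0` (`c₀Λ₀ ⊆ Λ_{W₀}`);
* `uniformize_half_cuspSymbol_eq_zero_of_mem_periodLatticeGamma1` — in the index-`4` world `Λ₁ = 2Λ₀`: `{∞,γ∞}_f ∈ Λ₁ ⟹ w₀ γ = 0`; hence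
  `…_of_cast_eq_one` (`d_γ ≡ 1 (mod N)`) and `…_of_cast_ceilSqrtLevel` (LEMMA M E-es-184 `diamondCharacterConductorLaw_holds`: `d_γ ≡ ±1 (mod M(N))`);
* `mem_periodLattice_iff_exists_cuspSymbol` — `Λ₀ = {cuspSymbol f γ}` as a SET ((K1));
* `four_le_ncard_range_uniformize_half_cuspSymbol` — for a LATTICE-OPTIMAL datum (`Λ_{W₀} ⊆ c₀Λ₀`) the values `w₀ γ` are exactly the four `2`-torsion points
  `π₀(0), π₀(ω₁/2), π₀(ω₂/2), π₀((ω₁+ω₂)/2)`, so `4 ≤ (Set.range w₀).ncard`.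
UNCONDITIONAL; nothing about E-es-185, C2, Manin's conjecture or BSD is proved.  No definitions, no sorry.
[cite: Manin1972, Prop. 1.4 / Thm. 1.6] [cite: Stevens1989, §2]
-/

set_option autoImplicit false
-- lint-debt: the directory name repeats the summit name (sibling precedent `ManinLocalTwoThreeDiamondCharacterConductorLaw.lean`)
set_option linter.dupNamespace false

noncomputable section

open scoped MatrixGroups
open CongruenceSubgroup WeierstrassCurve Literature.NumberTheory.EllipticCurves Literature.NumberTheory.EllipticCurves.ModularForms

namespace Summit.BirchSwinnertonDyer.BirchSwinnertonDyer.Theorems.ManinLocalTwoThree.StepTwo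

variable {N : ℕ} [NeZero N]

/-- **`Λ₀(f)` is the SET of cusp periods** `{∞, γ∞}_f` (the range of a homomorphism is a subgroup, (K1)). [cite: Manin1972, Prop. 1.4 / Thm. 1.6] -/
theorem mem_periodLattice_iff_exists_cuspSymbol (f : CuspForm (Gamma0 N) 2) (z : ℂ) :
    z ∈ periodLattice f ↔ ∃ γ : Gamma0 N, cuspSymbol f γ = z := by
  constructor
  · intro hz
    induction hz using AddSubgroup.closure_induction with
    | mem x hx => exact hx
    | zero => exact ⟨1, cuspSymbol_one f⟩
    | add x y _ _ hx hy =>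
      obtain ⟨γ, rfl⟩ := hx
      obtain ⟨δ, rfl⟩ := hy
      exact ⟨γ * δ, cuspSymbol_mul_holds f γ δ⟩
    | neg x _ hx =>
      obtain ⟨γ, rfl⟩ := hx
      refine ⟨γ⁻¹, ?_⟩
      have h := cuspSymbol_mul_holds f γ γ⁻¹
      rw [mul_inv_cancel, cuspSymbol_one] at h
      linear_combination -h
  · rintro ⟨γ, rfl⟩
    exact AddSubgroup.subset_closure ⟨γ, rfl⟩

variable {W₀ : WeierstrassCurve ℚ} (D₀ : ModularParametrizationData W₀ N)

/-- `w₀(γγ′) = w₀(γ) + w₀(γ′)` ((K1)). [cite: Manin1972, Prop. 1.4 / Thm. 1.6] -/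
theorem uniformize_half_cuspSymbol_mul (γ γ' : Gamma0 N) :
    D₀.uniformize ((D₀.c : ℂ) * cuspSymbol D₀.f (γ * γ') / 2) =
      D₀.uniformize ((D₀.c : ℂ) * cuspSymbol D₀.f γ / 2) + D₀.uniformize ((D₀.c : ℂ) * cuspSymbol D₀.f γ' / 2) := by
  rw [cuspSymbol_mul_holds, ← map_add]
  congr 1; ring

/-- `w₀(γ) + w₀(γ) = 0` (`c₀·{∞,γ∞}_f ∈ c₀Λ₀ ⊆ Λ_{W₀}`). [folklore] -/
theorem uniformize_half_cuspSymbol_add_self (γ : Gamma0 N) :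
    D₀.uniformize ((D₀.c : ℂ) * cuspSymbol D₀.f γ / 2) + D₀.uniformize ((D₀.c : ℂ) * cuspSymbol D₀.f γ / 2) = 0 := by
  rw [← map_add, ← two_mul, show 2 * ((D₀.c : ℂ) * cuspSymbol D₀.f γ / 2) = (D₀.c : ℂ) * cuspSymbol D₀.f γ by ring,
    D₀.uniformize_eq_zero_iff]
  exact D₀.smul_periodLattice_le _ (AddSubgroup.subset_closure ⟨γ, rfl⟩)

/-- In the index-`4` world `Λ₁ = 2Λ₀`: `{∞,γ∞}_f ∈ Λ₁(f) ⟹ w₀(γ) = 0`. [cite: Stevens1989, §2] -/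
theorem uniformize_half_cuspSymbol_eq_zero_of_mem_periodLatticeGamma1
    (h4 : ∀ z : ℂ, z ∈ periodLatticeGamma1 D₀.f ↔ ∃ w ∈ periodLattice D₀.f, z = 2 * w) {γ : Gamma0 N}
    (hγ : cuspSymbol D₀.f γ ∈ periodLatticeGamma1 D₀.f) : D₀.uniformize ((D₀.c : ℂ) * cuspSymbol D₀.f γ / 2) = 0 := by
  obtain ⟨w, hw, he⟩ := (h4 _).mp hγ
  rw [he, show (D₀.c : ℂ) * (2 * w) / 2 = (D₀.c : ℂ) * w by ring, D₀.uniformize_eq_zero_iff]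
  exact D₀.smul_periodLattice_le _ hw

/-- `d_γ ≡ 1 (mod N) ⟹ w₀(γ) = 0` in the index-`4` world (`γ ∈ Γ₁(N)`). [cite: Stevens1989, §2] -/
theorem uniformize_half_cuspSymbol_eq_zero_of_cast_eq_one
    (h4 : ∀ z : ℂ, z ∈ periodLatticeGamma1 D₀.f ↔ ∃ w ∈ periodLattice D₀.f, z = 2 * w) {γ : Gamma0 N}
    (hγ : ((((γ : SL(2, ℤ)) 1 1 : ℤ)) : ZMod N) = 1) : D₀.uniformize ((D₀.c : ℂ) * cuspSymbol D₀.f γ / 2) = 0 :=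
  uniformize_half_cuspSymbol_eq_zero_of_mem_periodLatticeGamma1 D₀ h4 (cuspSymbol_mem_periodLatticeGamma1_of_apply_eq_one _ γ hγ)

/-- **LEMMA M for `w₀`**: `d_γ ≡ ±1 (mod M(N))` ⟹ `w₀(γ) = 0` in the index-`4` world (E-es-184 `diamondCharacterConductorLaw_holds`).
[cite: Manin1972, Prop. 1.4 / Thm. 1.6] -/
theorem uniformize_half_cuspSymbol_eq_zero_of_cast_ceilSqrtLevel
    (h4 : ∀ z : ℂ, z ∈ periodLatticeGamma1 D₀.f ↔ ∃ w ∈ periodLattice D₀.f, z = 2 * w) {γ : Gamma0 N}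
    (hγ : ((((γ : SL(2, ℤ)) 1 1 : ℤ)) : ZMod (Summit.BirchSwinnertonDyer.Rank1Residual.ManinAdditive.KummerDiamond.ceilSqrtLevel N)) = 1 ∨
      ((((γ : SL(2, ℤ)) 1 1 : ℤ)) : ZMod (Summit.BirchSwinnertonDyer.Rank1Residual.ManinAdditive.KummerDiamond.ceilSqrtLevel N)) = -1) :
    D₀.uniformize ((D₀.c : ℂ) * cuspSymbol D₀.f γ / 2) = 0 :=
  uniformize_half_cuspSymbol_eq_zero_of_mem_periodLatticeGamma1 D₀ h4 (DiamondConductor.diamondCharacterConductorLaw_holds D₀.f γ hγ)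

/-- `π₀(x) = π₀(y) ↔ x − y ∈ Λ_{W₀}`. [folklore] -/
theorem uniformize_eq_uniformize_iff (x y : ℂ) : D₀.uniformize x = D₀.uniformize y ↔ x - y ∈ D₀.L.lattice := by
  rw [← sub_eq_zero, ← map_sub, D₀.uniformize_eq_zero_iff]

/-- **`|im w₀| ≥ 4` for a lattice-optimal datum**: the values `w₀(γ)` are the four `2`-torsion points `π₀(0), π₀(ω₁/2), π₀(ω₂/2), π₀((ω₁+ω₂)/2)`
(`Λ_{W₀} = c₀Λ₀` as sets and `Λ₀ = {cuspSymbol}`). [cite: Stevens1989, §2] -/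
theorem four_le_ncard_range_uniformize_half_cuspSymbol (hopt : ∀ z ∈ D₀.L.lattice, ∃ w ∈ periodLattice D₀.f, z = D₀.c * w) :
    4 ≤ (Set.range fun γ : Gamma0 N ↦ D₀.uniformize ((D₀.c : ℂ) * cuspSymbol D₀.f γ / 2)).ncard := by
  set L := D₀.L with hL
  -- every lattice half-point is a value
  have hval : ∀ ω ∈ L.lattice, D₀.uniformize (ω / 2) ∈ Set.range fun γ : Gamma0 N ↦ D₀.uniformize ((D₀.c : ℂ) * cuspSymbol D₀.f γ / 2) := by
    intro ω hω
    obtain ⟨w, hw, he⟩ := hopt ω hω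
    obtain ⟨γ, hγ⟩ := (mem_periodLattice_iff_exists_cuspSymbol D₀.f w).mp hw
    exact ⟨γ, by simp only; rw [hγ, ← he]⟩
  have hsub : ({D₀.uniformize (0 / 2), D₀.uniformize (L.ω₁ / 2), D₀.uniformize (L.ω₂ / 2), D₀.uniformize ((L.ω₁ + L.ω₂) / 2)} : Set _) ⊆
      Set.range fun γ : Gamma0 N ↦ D₀.uniformize ((D₀.c : ℂ) * cuspSymbol D₀.f γ / 2) := by
    intro P hP
    simp only [Set.mem_insert_iff, Set.mem_singleton_iff] at hP
    rcases hP with rfl | rfl | rfl | rfl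
    · exact hval 0 (zero_mem _)
    · exact hval _ L.ω₁_mem_lattice
    · exact hval _ L.ω₂_mem_lattice
    · exact hval _ (add_mem L.ω₁_mem_lattice L.ω₂_mem_lattice)
  -- the range is contained in the four points (so it is finite)
  have hsup : (Set.range fun γ : Gamma0 N ↦ D₀.uniformize ((D₀.c : ℂ) * cuspSymbol D₀.f γ / 2)) ⊆
      ({D₀.uniformize (0 / 2), D₀.uniformize (L.ω₁ / 2), D₀.uniformize (L.ω₂ / 2), D₀.uniformize ((L.ω₁ + L.ω₂) / 2)} : Set _) := by
    rintro _ ⟨γ, rfl⟩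
    have hmem : (D₀.c : ℂ) * cuspSymbol D₀.f γ ∈ L.lattice := D₀.smul_periodLattice_le _ (AddSubgroup.subset_closure ⟨γ, rfl⟩)
    obtain ⟨m, n, hmn⟩ := PeriodPair.mem_lattice.mp hmem
    simp only [Set.mem_insert_iff, Set.mem_singleton_iff]
    rw [← hmn]
    have key : ∀ (k l : ℤ) (z t : ℂ), z = (2 * k : ℤ) * L.ω₁ + (2 * l : ℤ) * L.ω₂ + t →
        D₀.uniformize (z / 2) = D₀.uniformize (t / 2) := by
      intro k l z t hz
      rw [uniformize_eq_uniformize_iff, PeriodPair.mem_lattice]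
      exact ⟨k, l, by rw [hz]; push_cast; ring⟩
    rcases Int.even_or_odd' m with ⟨k, hk | hk⟩ <;> rcases Int.even_or_odd' n with ⟨l, hl | hl⟩ <;> rw [hk, hl]
    · left; exact key k l _ 0 (by push_cast; ring)
    · right; right; left; exact key k l _ _ (by push_cast; ring)
    · right; left; exact key k l _ _ (by push_cast; ring)
    · right; right; right; exact key k l _ _ (by push_cast; ring)
  -- the four points are pairwise distinct
  have hfin : (Set.range fun γ : Gamma0 N ↦ D₀.uniformize ((D₀.c : ℂ) * cuspSymbol D₀.f γ / 2)).Finite :=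
    Set.Finite.subset (Set.toFinite _) hsup
  have h4 : ({D₀.uniformize (0 / 2), D₀.uniformize (L.ω₁ / 2), D₀.uniformize (L.ω₂ / 2), D₀.uniformize ((L.ω₁ + L.ω₂) / 2)} : Set _).ncard = 4 := by
    have n01 : D₀.uniformize (0 / 2) ≠ D₀.uniformize (L.ω₁ / 2) := by
      rw [Ne, uniformize_eq_uniformize_iff, zero_div, zero_sub, neg_mem_iff]; exact L.ω₁_div_two_notMem_lattice
    have n02 : D₀.uniformize (0 / 2) ≠ D₀.uniformize (L.ω₂ / 2) := by
      rw [Ne, uniformize_eq_uniformize_iff, zero_div, zero_sub, neg_mem_iff]; exact L.ω₂_div_two_notMem_lattice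
    have n03 : D₀.uniformize (0 / 2) ≠ D₀.uniformize ((L.ω₁ + L.ω₂) / 2) := by
      rw [Ne, uniformize_eq_uniformize_iff, zero_div, zero_sub, neg_mem_iff]
      have h := (L.mul_ω₁_add_mul_ω₂_mem_lattice (α := 1 / 2) (β := 1 / 2)).not.mpr (by norm_num)
      intro hmem; apply h; convert hmem using 1; push_cast; ring
    have n12 : D₀.uniformize (L.ω₁ / 2) ≠ D₀.uniformize (L.ω₂ / 2) := by
      rw [Ne, uniformize_eq_uniformize_iff]
      have h := (L.mul_ω₁_add_mul_ω₂_mem_lattice (α := 1 / 2) (β := -1 / 2)).not.mpr (by norm_num)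
      intro hmem; apply h; convert hmem using 1; push_cast; ring
    have n13 : D₀.uniformize (L.ω₁ / 2) ≠ D₀.uniformize ((L.ω₁ + L.ω₂) / 2) := by
      rw [Ne, uniformize_eq_uniformize_iff]
      intro hmem; apply L.ω₂_div_two_notMem_lattice
      have := neg_mem hmem
      convert this using 1; ring
    have n23 : D₀.uniformize (L.ω₂ / 2) ≠ D₀.uniformize ((L.ω₁ + L.ω₂) / 2) := by
      rw [Ne, uniformize_eq_uniformize_iff]
      intro hmem; apply L.ω₁_div_two_notMem_lattice
      have := neg_mem hmem
      convert this using 1; ring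
    rw [Set.ncard_insert_of_notMem (by simp only [Set.mem_insert_iff, Set.mem_singleton_iff, not_or]; exact ⟨n01, n02, n03⟩),
      Set.ncard_insert_of_notMem (by simp only [Set.mem_insert_iff, Set.mem_singleton_iff, not_or]; exact ⟨n12, n13⟩),
      Set.ncard_pair n23]
  rw [← h4]
  exact Set.ncard_le_ncard hsub hfin

end Summit.BirchSwinnertonDyer.BirchSwinnertonDyer.Theorems.ManinLocalTwoThree.StepTwo

end
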